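import Summits.AtomisticToContinuum.Crystallization.Theorems.ExcessDecayLiouvilleCoarseGrainsPinFromSeries
import Summits.AtomisticToContinuum.Crystallization.Theorems.ExcessDecayLiouvilleCoarseGrainsHcpEnergySeries
import Summits.AtomisticToContinuum.Crystallization.Theorems.ExcessDecayLiouvilleCoarseGrainsPinTail
import Summits.AtomisticToContinuum.Crystallization.Theorems.SlackRigidity.Negative.WitnessBasics
import HarnessLib

/-!
# Crux `SlackRigidity` (stmt-AtomisticToContinuum-11960), line `ekeland-surgery-parity`:
# `stub_hcpOptimalCongruent` from two certified-numerics statements about the hcp shape sums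

Landed ANALYSIS half of the reshape of the registered stub `stub_hcpOptimalCongruent` (box-minimisers of `(a,h) ↦ e(hcp(a,h))` on
`[1/2,2]²` give congruent stackings) into two NUMERICS stubs about the tree's lattice sums
`hcpSumS e c = ∑_{v ≠ 0} (Q v + k²c²)⁻ᵉ` (`…CoarseGrainsPinSums`), `G(c) := S₃(c)²/S₆(c)`:

* `stub_hcpShapeExclusion` — outside the middle window `M = [7/10, 9/10]` of the shape ratio
  `c = h/a ∈ [1/4, 4]`, `G(c) < G(c₀)` at the reference shape `c₀ = 4083/5000 ∈ M`; and on `M` the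
  crude ratio bounds `S₆ ≤ 2 S₃`, `S₃ ≤ 2 S₆` (feasibility of the optimally dilated competitors);
* `stub_hcpShapeUniqueMax` — `G` has at most one maximiser on `M` (certified `F' > 0` for the Fermat
  function `F = S₆D₃ − S₃D₆`, i.e. `G` is strictly unimodal on `M`),

and the ANALYSIS deriving the registered stub from them (this file: the two numerics statements enter
as HYPOTHESES of `hcpOptimalCongruent_of_numerics`; no `sorry`): by the landed series identity (`stub_hcpEnergySeries`, Blanc–Lewin 2015 §2.1 (23))
`e(hcp(a, ac)) = ½(a⁻¹² S₆(c)/12 − a⁻⁶ S₃(c)/6) ≥ −G(c)/24` with equality iff `a⁶ = S₆(c)/S₃(c)`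
(`hcpPinC_energy_formula`, `hcpPinC_dilation_value/eq`); a box-minimiser is compared with the optimally
dilated stacking of every shape `c' ∈ M` (in the box by the ratio bounds), so its shape `c` lies in `M`
(exclusion), maximises `G` on `M`, and its spacing is `a⁶ = S₆(c)/S₃(c)`; two box-minimisers therefore
have the same `(c, a)`, hence the same `(a, h)`. [folklore]
-/

noncomputable section

namespace Summit.AtomisticToContinuum.Crystallization.Theorems.EkelandSurgeryParityHcpUniq

open Literature.MathematicalPhysics.StatisticalMechanics
open Summit.AtomisticToContinuum.Crystallization.Theorems.ExcessDecayLiouvilleCoarseGrains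
open Summit.AtomisticToContinuum.Crystallization.Theorems.SlackRigidityNegative (E3)

/-! ## Analysis: from the numerics to the registered stub -/

/-- The tree's `hcpSumS` is the `ℤ³`-indexed series of the line's statements. [folklore] -/
theorem hcpSumS_eq_tsum (e : ℕ) (c : ℝ) :
    hcpSumS e c = ∑' v : ℤ × ℤ × ℤ, if v = 0 then (0 : ℝ) else
      ((((v.2.1 : ℝ) ^ 2 + (v.2.1 : ℝ) * v.2.2 + (v.2.2 : ℝ) ^ 2 +
        (if Even v.1 then 0 else ((v.2.1 : ℝ) + v.2.2 + 1 / 3))) + (v.1 : ℝ) ^ 2 * c ^ 2)⁻¹) ^ e := by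
  rfl

/-- **Structure of a box-minimiser.**  If `(a, h) ∈ [1/2,2]²` minimises `e(hcp(·,·))` over the box then,
granted the two numerics stubs' content as hypotheses, its shape `c = h/a` lies in `M = [7/10, 9/10]`,
maximises `G = S₃²/S₆` on `M`, and `a⁶ = S₆(c)/S₃(c)`. [folklore] -/
theorem boxMinimiser_spec
    (hExcl : (∀ c : ℝ, 1 / 4 ≤ c → c ≤ 4 → (c < 7 / 10 ∨ 9 / 10 < c) →
      hcpSumS 3 c ^ 2 / hcpSumS 6 c <
        hcpSumS 3 ((4083 : ℝ) / 5000) ^ 2 / hcpSumS 6 ((4083 : ℝ) / 5000)) ∧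
    (∀ c : ℝ, 7 / 10 ≤ c → c ≤ 9 / 10 →
      0 < hcpSumS 3 c ∧ 0 < hcpSumS 6 c ∧
        hcpSumS 6 c ≤ 2 * hcpSumS 3 c ∧ hcpSumS 3 c ≤ 2 * hcpSumS 6 c))
    {a h : ℝ} (ha : a ≠ 0) (hh : h ≠ 0)
    (ha1 : 1 / 2 ≤ a) (ha2 : a ≤ 2) (hh1 : 1 / 2 ≤ h) (hh2 : h ≤ 2)
    (hmin : ∀ (b k : ℝ) (hb : b ≠ 0) (hk : k ≠ 0), 1 / 2 ≤ b → b ≤ 2 → 1 / 2 ≤ k → k ≤ 2 →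
      (hcpPeriodicConfiguration ha hh).energyPerParticle lennardJones ≤
        (hcpPeriodicConfiguration hb hk).energyPerParticle lennardJones) :
    7 / 10 ≤ h / a ∧ h / a ≤ 9 / 10 ∧
      (∀ x : ℝ, 7 / 10 ≤ x → x ≤ 9 / 10 →
        hcpSumS 3 x ^ 2 / hcpSumS 6 x ≤ hcpSumS 3 (h / a) ^ 2 / hcpSumS 6 (h / a)) ∧
      a ^ 6 = hcpSumS 6 (h / a) / hcpSumS 3 (h / a) := by
  obtain ⟨hexcl, hratio⟩ := hExcl
  set Q : ℤ × ℤ × ℤ → ℝ := fun v => (v.2.1 : ℝ) ^ 2 + (v.2.1 : ℝ) * v.2.2 + (v.2.2 : ℝ) ^ 2 +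
    (if Even v.1 then 0 else ((v.2.1 : ℝ) + v.2.2 + 1 / 3)) with hQ
  have hQ0 : ∀ v, 0 ≤ Q v := hcpPinC_Q_nonneg
  have hQ1 : ∀ v : ℤ × ℤ × ℤ, v ≠ 0 → v.1 = 0 → 0 < Q v := hcpPinC_Q_pos
  have hS : ∀ (n : ℕ) (c' : ℝ), hcpSumS n c' = ∑' v : ℤ × ℤ × ℤ,
      if v = 0 then (0 : ℝ) else ((Q v + (v.1 : ℝ) ^ 2 * c' ^ 2)⁻¹) ^ n :=
    fun n c' => hcpSumS_eq_tsum n c'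
  have ha0 : 0 < a := by linarith
  set c := h / a with hc
  have hhc : h = a * c := by rw [hc]; field_simp
  have hc0 : 0 < c := by rw [hc]; positivity
  have hcne : c ≠ 0 := hc0.ne'
  -- the series identity (A) at every `(a', h')`
  have hA : ∀ (a' h' : ℝ) (ha' : a' ≠ 0) (hh' : h' ≠ 0),
      (Summable fun v : ℤ × ℤ × ℤ =>
        if v = 0 then (0 : ℝ) else ((a' ^ 2 * Q v + (v.1 : ℝ) ^ 2 * h' ^ 2)⁻¹) ^ 3) ∧
      (Summable fun v : ℤ × ℤ × ℤ =>
        if v = 0 then (0 : ℝ) else lennardJones (Real.sqrt (a' ^ 2 * Q v + (v.1 : ℝ) ^ 2 * h' ^ 2))) ∧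
      (hcpPeriodicConfiguration ha' hh').energyPerParticle lennardJones =
        (1 / 2) * ∑' v : ℤ × ℤ × ℤ,
          if v = 0 then (0 : ℝ) else lennardJones (Real.sqrt (a' ^ 2 * Q v + (v.1 : ℝ) ^ 2 * h' ^ 2)) :=
    fun a' h' ha' hh' => hcpEnergySeries_of_eq a' h' ha' hh' Q hQ
  -- summability and positivity of the shape sums at every `c' ≠ 0`
  have hT : ∀ c' : ℝ, c' ≠ 0 →
      (Summable fun v : ℤ × ℤ × ℤ =>
        if v = 0 then (0 : ℝ) else ((Q v + (v.1 : ℝ) ^ 2 * c' ^ 2)⁻¹) ^ 3) ∧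
      (Summable fun v : ℤ × ℤ × ℤ =>
        if v = 0 then (0 : ℝ) else ((Q v + (v.1 : ℝ) ^ 2 * c' ^ 2)⁻¹) ^ 6) := by
    intro c' hc'
    obtain ⟨h1, h2, h3⟩ := hA 1 c' one_ne_zero hc'
    have key := hcpPinC_energy_formula Q hQ0 one_ne_zero h1 h2 h3
    rw [div_one] at key
    exact ⟨key.1, key.2.1⟩
  have hSpos : ∀ c' : ℝ, c' ≠ 0 → 0 < hcpSumS 3 c' ∧ 0 < hcpSumS 6 c' := by
    intro c' hc'
    rw [hS, hS]
    exact ⟨hcpPinC_tsum_pos hQ0 hQ1 hc' 3 (hT c' hc').1, hcpPinC_tsum_pos hQ0 hQ1 hc' 6 (hT c' hc').2⟩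
  -- the energy per particle of `hcp(a', a' c')`
  have hE : ∀ (a' c' : ℝ) (ha' : a' ≠ 0) (hh' : a' * c' ≠ 0),
      (hcpPeriodicConfiguration ha' hh').energyPerParticle lennardJones =
        1 / 2 * ((1 / 12) * (a' ^ 12)⁻¹ * hcpSumS 6 c' - (1 / 6) * (a' ^ 6)⁻¹ * hcpSumS 3 c') := by
    intro a' c' ha' hh'
    obtain ⟨h1, h2, h3⟩ := hA a' (a' * c') ha' hh'
    have key := (hcpPinC_energy_formula Q hQ0 ha' h1 h2 h3).2.2
    rw [mul_div_cancel_left₀ c' ha'] at key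
    rw [hS, hS]
    exact key
  -- the energy at `(a, h)` as a function of the shape sums at `c`
  have hahc : a * c ≠ 0 := mul_ne_zero ha hcne
  have he : (hcpPeriodicConfiguration ha hh).energyPerParticle lennardJones =
      1 / 2 * ((1 / 12) * (a ^ 12)⁻¹ * hcpSumS 6 c - (1 / 6) * (a ^ 6)⁻¹ * hcpSumS 3 c) := by
    have key := hE a c ha hahc
    convert key using 3
  obtain ⟨hS3c, hS6c⟩ := hSpos c hcne
  -- the parabola bound at `(a, h)`: `e ≥ -G(c)/24`
  have hpar : -(hcpSumS 3 c ^ 2 / (24 * hcpSumS 6 c)) ≤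
      (hcpPeriodicConfiguration ha hh).energyPerParticle lennardJones := by
    rw [he]
    have key : 1 / 2 * ((1 / 12) * (a ^ 12)⁻¹ * hcpSumS 6 c - (1 / 6) * (a ^ 6)⁻¹ * hcpSumS 3 c) +
        hcpSumS 3 c ^ 2 / (24 * hcpSumS 6 c) =
        (hcpSumS 6 c - hcpSumS 3 c * a ^ 6) ^ 2 / (24 * hcpSumS 6 c * a ^ 12) := by
      field_simp
      ring
    have : 0 ≤ (hcpSumS 6 c - hcpSumS 3 c * a ^ 6) ^ 2 / (24 * hcpSumS 6 c * a ^ 12) := by positivity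
    linarith
  -- comparison with the optimally dilated stacking of any shape `c' ∈ M` (it lies in the box)
  have hI : ∀ c' : ℝ, 7 / 10 ≤ c' → c' ≤ 9 / 10 →
      (hcpPeriodicConfiguration ha hh).energyPerParticle lennardJones ≤
        -(hcpSumS 3 c' ^ 2 / (24 * hcpSumS 6 c')) := by
    intro c' h1 h2
    have hc'0 : 0 < c' := by linarith
    obtain ⟨h3, h6, hr1, hr2⟩ := hratio c' h1 h2
    have hq : 0 < hcpSumS 6 c' / hcpSumS 3 c' := div_pos h6 h3
    obtain ⟨b, hb0, hb6⟩ : ∃ b : ℝ, 0 < b ∧ b ^ 6 = hcpSumS 6 c' / hcpSumS 3 c' :=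
      ⟨(hcpSumS 6 c' / hcpSumS 3 c') ^ ((6 : ℕ) : ℝ)⁻¹, Real.rpow_pos_of_pos hq _,
        Real.rpow_inv_natCast_pow hq.le (by norm_num)⟩
    -- feasibility: `b ∈ [1/2, 2]`, `b c' ∈ [1/2, 2]` from `b⁶ ∈ [1/2, 2]`
    have hb6lo : 1 / 2 ≤ b ^ 6 := by
      rw [hb6, le_div_iff₀ h3]; linarith
    have hb6hi : b ^ 6 ≤ 2 := by
      rw [hb6, div_le_iff₀ h3]; linarith
    have hn6 : (6 : ℕ) ≠ 0 := by norm_num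
    have hblo : 1 / 2 ≤ b := by
      refine (pow_le_pow_iff_left₀ (by norm_num) hb0.le hn6).1 (le_trans ?_ hb6lo)
      norm_num
    have hbhi : b ≤ 2 := by
      refine (pow_le_pow_iff_left₀ hb0.le (by norm_num) hn6).1 (hb6hi.trans ?_)
      norm_num
    have hbc0 : 0 ≤ b * c' := by positivity
    have hbc6 : (b * c') ^ 6 = c' ^ 6 * b ^ 6 := by ring
    have hc6lo : (7 / 10 : ℝ) ^ 6 ≤ c' ^ 6 := pow_le_pow_left₀ (by norm_num) h1 6
    have hc6hi : c' ^ 6 ≤ (9 / 10 : ℝ) ^ 6 := pow_le_pow_left₀ hc'0.le h2 6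
    have hbclo : 1 / 2 ≤ b * c' := by
      refine (pow_le_pow_iff_left₀ (by norm_num) hbc0 hn6).1 ?_
      rw [hbc6]
      nlinarith
    have hbchi : b * c' ≤ 2 := by
      refine (pow_le_pow_iff_left₀ hbc0 (by norm_num) hn6).1 ?_
      rw [hbc6]
      nlinarith
    have key := hmin b (b * c') hb0.ne' (mul_ne_zero hb0.ne' hc'0.ne') hblo hbhi hbclo hbchi
    rw [hE b c' hb0.ne' (mul_ne_zero hb0.ne' hc'0.ne'), hcpPinC_dilation_value h3 h6 hb6] at key
    exact key
  -- shape comparison `G(c') ≤ G(c)` for every `c' ∈ M`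
  have hshape : ∀ c' : ℝ, 7 / 10 ≤ c' → c' ≤ 9 / 10 →
      hcpSumS 3 c' ^ 2 / hcpSumS 6 c' ≤ hcpSumS 3 c ^ 2 / hcpSumS 6 c := by
    intro c' h1 h2
    obtain ⟨-, h6', -, -⟩ := hratio c' h1 h2
    exact hcpPinC_shape_le hS6c h6' (hpar.trans (hI c' h1 h2))
  -- the shape lies in `M` (exclusion numerics at `c₀ = 4083/5000 ∈ M`)
  have hcM : 7 / 10 ≤ c ∧ c ≤ 9 / 10 := by
    have hc4 : 1 / 4 ≤ c ∧ c ≤ 4 := by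
      rw [hc]
      constructor
      · rw [le_div_iff₀ ha0]; linarith
      · rw [div_le_iff₀ ha0]; linarith
    by_contra hnot
    have hout : c < 7 / 10 ∨ 9 / 10 < c := by
      rcases not_and_or.1 hnot with h' | h'
      · exact Or.inl (lt_of_not_ge h')
      · exact Or.inr (lt_of_not_ge h')
    have h1 := hexcl c hc4.1 hc4.2 hout
    have h2 := hshape ((4083 : ℝ) / 5000) (by norm_num) (by norm_num)
    linarith
  -- optimal dilation at `c` itself
  have ha6 : a ^ 6 = hcpSumS 6 c / hcpSumS 3 c :=
    hcpPinC_dilation_eq hS3c hS6c ha (by rw [← he]; exact hI c hcM.1 hcM.2)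
  exact ⟨hcM.1, hcM.2, hshape, ha6⟩

/-- **The registered stub from the two numerics stubs' content** (statement of
`stub_hcpOptimalCongruent` verbatim): two box-minimisers have the same shape (unique maximiser of
`G` on `M`) and the same spacing (`a⁶ = S₆/S₃` at that shape), hence coincide. [folklore] -/
theorem hcpOptimalCongruent_of_numerics'
    (hExcl : (∀ c : ℝ, 1 / 4 ≤ c → c ≤ 4 → (c < 7 / 10 ∨ 9 / 10 < c) →
      hcpSumS 3 c ^ 2 / hcpSumS 6 c <
        hcpSumS 3 ((4083 : ℝ) / 5000) ^ 2 / hcpSumS 6 ((4083 : ℝ) / 5000)) ∧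
    (∀ c : ℝ, 7 / 10 ≤ c → c ≤ 9 / 10 →
      0 < hcpSumS 3 c ∧ 0 < hcpSumS 6 c ∧
        hcpSumS 6 c ≤ 2 * hcpSumS 3 c ∧ hcpSumS 3 c ≤ 2 * hcpSumS 6 c))
    (hUniq : ∀ c c' : ℝ, 7 / 10 ≤ c → c ≤ 9 / 10 → 7 / 10 ≤ c' → c' ≤ 9 / 10 →
      (∀ x : ℝ, 7 / 10 ≤ x → x ≤ 9 / 10 →
        hcpSumS 3 x ^ 2 / hcpSumS 6 x ≤ hcpSumS 3 c ^ 2 / hcpSumS 6 c) →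
      (∀ x : ℝ, 7 / 10 ≤ x → x ≤ 9 / 10 →
        hcpSumS 3 x ^ 2 / hcpSumS 6 x ≤ hcpSumS 3 c' ^ 2 / hcpSumS 6 c') →
      c = c') :
    ∀ (a h a' h' : ℝ) (ha : a ≠ 0) (hh : h ≠ 0) (ha' : a' ≠ 0) (hh' : h' ≠ 0),
    1 / 2 ≤ a → a ≤ 2 → 1 / 2 ≤ h → h ≤ 2 → 1 / 2 ≤ a' → a' ≤ 2 → 1 / 2 ≤ h' → h' ≤ 2 →
    (∀ (b k : ℝ) (hb : b ≠ 0) (hk : k ≠ 0), 1 / 2 ≤ b → b ≤ 2 → 1 / 2 ≤ k → k ≤ 2 →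
      (hcpPeriodicConfiguration ha hh).energyPerParticle lennardJones ≤
        (hcpPeriodicConfiguration hb hk).energyPerParticle lennardJones) →
    (∀ (b k : ℝ) (hb : b ≠ 0) (hk : k ≠ 0), 1 / 2 ≤ b → b ≤ 2 → 1 / 2 ≤ k → k ≤ 2 →
      (hcpPeriodicConfiguration ha' hh').energyPerParticle lennardJones ≤
        (hcpPeriodicConfiguration hb hk).energyPerParticle lennardJones) →
    ∃ B : E3 →ₗᵢ[ℝ] E3, hcpStacking a' h' = B '' hcpStacking a h := by
  intro a h a' h' ha hh ha' hh' ha1 ha2 hh1 hh2 ha1' ha2' hh1' hh2' hmin hmin'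
  obtain ⟨hc1, hc2, hmax, ha6⟩ := boxMinimiser_spec hExcl ha hh ha1 ha2 hh1 hh2 hmin
  obtain ⟨hc1', hc2', hmax', ha6'⟩ := boxMinimiser_spec hExcl ha' hh' ha1' ha2' hh1' hh2' hmin'
  have hcc : h / a = h' / a' := hUniq (h / a) (h' / a') hc1 hc2 hc1' hc2' hmax hmax'
  have ha0 : 0 < a := by linarith
  have ha0' : 0 < a' := by linarith
  have haa : a = a' := by
    have h66 : a ^ 6 = a' ^ 6 := by rw [ha6, ha6', hcc]
    exact le_antisymm
      ((pow_le_pow_iff_left₀ ha0.le ha0'.le (by norm_num : (6 : ℕ) ≠ 0)).1 h66.le)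
      ((pow_le_pow_iff_left₀ ha0'.le ha0.le (by norm_num : (6 : ℕ) ≠ 0)).1 h66.ge)
  have hhh : h = h' := by
    have e1 : h = a * (h / a) := by field_simp
    have e2 : h' = a' * (h' / a') := by field_simp
    rw [e1, e2, hcc, haa]
  subst haa hhh
  exact ⟨LinearIsometry.id, by simp⟩

/-- **Registered sub-goal `hcpOptimalCongruent_of_numerics` (stmt-AtomisticToContinuum-11960, line
`ekeland-surgery-parity`)**: the shape-exclusion numerics and the uniqueness of the maximiser of
`S₃²/S₆` on `[7/10, 9/10]` imply the statement of the registered stub `stub_hcpOptimalCongruent`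
(box-minimisers of `e(hcp(a,h))` on `[1/2,2]²` are congruent). [folklore] -/
theorem hcpOptimalCongruent_of_numerics :
    ((∀ c : ℝ, 1 / 4 ≤ c → c ≤ 4 → (c < 7 / 10 ∨ 9 / 10 < c) →
      hcpSumS 3 c ^ 2 / hcpSumS 6 c <
        hcpSumS 3 ((4083 : ℝ) / 5000) ^ 2 / hcpSumS 6 ((4083 : ℝ) / 5000)) ∧
    (∀ c : ℝ, 7 / 10 ≤ c → c ≤ 9 / 10 →
      0 < hcpSumS 3 c ∧ 0 < hcpSumS 6 c ∧
        hcpSumS 6 c ≤ 2 * hcpSumS 3 c ∧ hcpSumS 3 c ≤ 2 * hcpSumS 6 c)) →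
    (∀ c c' : ℝ, 7 / 10 ≤ c → c ≤ 9 / 10 → 7 / 10 ≤ c' → c' ≤ 9 / 10 →
      (∀ x : ℝ, 7 / 10 ≤ x → x ≤ 9 / 10 →
        hcpSumS 3 x ^ 2 / hcpSumS 6 x ≤ hcpSumS 3 c ^ 2 / hcpSumS 6 c) →
      (∀ x : ℝ, 7 / 10 ≤ x → x ≤ 9 / 10 →
        hcpSumS 3 x ^ 2 / hcpSumS 6 x ≤ hcpSumS 3 c' ^ 2 / hcpSumS 6 c') →
      c = c') →
    ∀ (a h a' h' : ℝ) (ha : a ≠ 0) (hh : h ≠ 0) (ha' : a' ≠ 0) (hh' : h' ≠ 0),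
    1 / 2 ≤ a → a ≤ 2 → 1 / 2 ≤ h → h ≤ 2 → 1 / 2 ≤ a' → a' ≤ 2 → 1 / 2 ≤ h' → h' ≤ 2 →
    (∀ (b k : ℝ) (hb : b ≠ 0) (hk : k ≠ 0), 1 / 2 ≤ b → b ≤ 2 → 1 / 2 ≤ k → k ≤ 2 →
      (hcpPeriodicConfiguration ha hh).energyPerParticle lennardJones ≤
        (hcpPeriodicConfiguration hb hk).energyPerParticle lennardJones) →
    (∀ (b k : ℝ) (hb : b ≠ 0) (hk : k ≠ 0), 1 / 2 ≤ b → b ≤ 2 → 1 / 2 ≤ k → k ≤ 2 →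
      (hcpPeriodicConfiguration ha' hh').energyPerParticle lennardJones ≤
        (hcpPeriodicConfiguration hb hk).energyPerParticle lennardJones) →
    ∃ B : E3 →ₗᵢ[ℝ] E3, hcpStacking a' h' = B '' hcpStacking a h :=
  fun hExcl hUniq => hcpOptimalCongruent_of_numerics' hExcl hUniq

end Summit.AtomisticToContinuum.Crystallization.Theorems.EkelandSurgeryParityHcpUniq

end
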